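import Literature.MathematicalPhysics.QuantumLattice.SegmentParallelTransport
import Mathlib.Analysis.Calculus.Deriv.Star
import Mathlib.Algebra.Star.Unitary
import HarnessLib

/-!
# Unitarity of the segment transport for skew-adjoint connections

QuantumLattice support file (everything proved; no definitions, no named facts) on the proof
path of `Literature.MathematicalPhysics.QuantumLattice.Waldron2019_yangMillsFlow_flatTorus`
(A. Waldron, Invent. math. 217 (2019)), Lemma 3.5 / §4 (good gauges): for a connection with
values in the skew-adjoint part of a Banach `*`-algebra (`star (A y v) = −A y v`, e.g. `𝔲(N)`),
the segment transport `segPT` and the exponential gauge `expGauge` of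
`SegmentParallelTransport` are unitary: `star g * g = 1 = g * star g`
(`star_segPT_mul_self`, `segPT_mul_star_self`, `expGauge_mem_unitary`). Proof:
`d/dτ (u⋆ u) = −u⋆ (a⋆ + a) u = 0`.

References: A. Waldron, Invent. math. 217 (2019), §3–§4 [Waldron2019]; [folklore].
-/

noncomputable section

open Set Metric Filter
open scoped Topology

namespace Literature.MathematicalPhysics.QuantumLattice

universe u

section Unitary

variable {E : Type u} [NormedAddCommGroup E] [InnerProductSpace ℝ E] [CompleteSpace E]
variable {𝔸 : Type u} [NormedRing 𝔸] [NormedAlgebra ℝ 𝔸] [CompleteSpace 𝔸]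
variable [StarRing 𝔸] [ContinuousStar 𝔸] [StarModule ℝ 𝔸]

/-- **`u⋆ u = 1` along the transport** of a skew-adjoint connection. [folklore] -/
theorem star_segPT_mul_self {A : Connection E 𝔸} (hA : ContDiff ℝ 1 A)
    (hskew : ∀ y v, star (A y v) = -A y v) (c x : E) {τ : ℝ}
    (hτ : τ ∈ Ioo (-(3/2 : ℝ)) (3/2)) : star (segPT c A x τ) * segPT c A x τ = 1 := by
  have hO : IsOpen (Ioo (-(3/2 : ℝ)) (3/2)) := isOpen_Ioo
  have h0mem : (0 : ℝ) ∈ Ioo (-(3/2 : ℝ)) (3/2) := by constructor <;> norm_num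
  have hd : ∀ σ ∈ Ioo (-(3/2 : ℝ)) (3/2),
      HasDerivAt (fun σ => star (segPT c A x σ) * segPT c A x σ) 0 σ := by
    intro σ hσ
    have hu := hasDerivAt_segPT hA c x hσ
    have hsu := hu.star
    have h := hsu.mul hu
    have hzero : star (-(A (c + σ • (x - c)) (x - c) * segPT c A x σ)) * segPT c A x σ +
        star (segPT c A x σ) * -(A (c + σ • (x - c)) (x - c) * segPT c A x σ) = 0 := by
      rw [star_neg, star_mul, hskew]
      noncomm_ring
    rwa [hzero] at h
  have hconst := hO.is_const_of_deriv_eq_zero (convex_Ioo _ _).isPreconnected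
    (fun σ hσ => (hd σ hσ).differentiableAt.differentiableWithinAt) (fun σ hσ => (hd σ hσ).deriv)
    hτ h0mem
  rw [hconst, segPT_zero hA, star_one, one_mul]

/-- **`u u⋆ = 1`** (a left inverse of a unit is a right inverse). [folklore] -/
theorem segPT_mul_star_self {A : Connection E 𝔸} (hA : ContDiff ℝ 1 A)
    (hskew : ∀ y v, star (A y v) = -A y v) (c x : E) {τ : ℝ}
    (hτ : τ ∈ Ioo (-(3/2 : ℝ)) (3/2)) : segPT c A x τ * star (segPT c A x τ) = 1 := by
  obtain ⟨w, huw, hwu⟩ := isUnit_iff_exists.1 (isUnit_segPT hA c x hτ)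
  have hs := star_segPT_mul_self hA hskew c x hτ
  -- `star u = star u * (u * w) = (star u * u) * w = w`
  have hw : star (segPT c A x τ) = w := by
    calc star (segPT c A x τ) = star (segPT c A x τ) * (segPT c A x τ * w) := by rw [huw, mul_one]
      _ = w := by rw [← mul_assoc, hs, one_mul]
  rw [hw, huw]

/-- **The exponential gauge of a skew-adjoint connection is unitary.** [folklore] -/
theorem expGauge_mem_unitary {A : Connection E 𝔸} (hA : ContDiff ℝ 1 A)
    (hskew : ∀ y v, star (A y v) = -A y v) (c x : E) : expGauge c A x ∈ unitary 𝔸 :=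
  Unitary.mem_iff.2 ⟨star_segPT_mul_self hA hskew c x one_mem_Ioo32,
    segPT_mul_star_self hA hskew c x one_mem_Ioo32⟩

end Unitary

end Literature.MathematicalPhysics.QuantumLattice
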